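import Literature.AnabelianGeometry.EtaleTheta.SettingModelCurve
import Literature.AnabelianGeometry.SemiGraphs.OncePuncturedTemperedGroupWitness
import Literature.AnabelianGeometry.SemiGraphs.ProfiniteCompletionEta
import HarnessLib

/-!
# A FINER model of the [EtTh] §1 root, part A: the tempered-curve layer with `Δ^tp := F̂₂ ×_Ẑ ℤ`

Mochizuki, *The étale theta function …*, Publ. RIMS **45** (2009) [EtTh], §1, PRIMS PDF pp. 11–12
[cite: MochizukiEtTh2009, §1 p.12]: "`Π^tp_X`", "the natural surjection `Π^tp_X ↠ Z`",
"`Π_X := (Π^tp_X)^∧`", "`Δ_X` … a profinite free group on 2 generators". Layer L2 of the abc-iut cell, seat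
abc-iut-L2-t1 (root owner); vacuity lane, sequel of `SettingModelCurve.lean`.

The first root model (`SettingModelCurve`/`SettingModel`: `Π^tp := F₂ × G_{ℚ_p}` DISCRETE) is degenerate
along the tempered topology — so degenerate that the printed closedness sentence "(Δ^tp_Y)^Θ is profinite"
(the binder `hYcl`, GAP G-w4d021-2) FAILS in it (`SettingModelIndependence.hYcl_not_derivable`). THIS file
starts the FINER model, replacing the discrete `F₂` by abc-iut-w5-d218's genuinely tempered group
`Γ := F̂₂ ×_Ẑ ℤ ≤ F̂₂ × ℤ` (`SemiGraphs/TemperedFibreProduct*.lean`: pro-discrete, complete, slim; `pr₁` an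
injective profinite completion; `pr₂ : Γ ↠ ℤ` with OPEN PROFINITE kernel `Ker ê × 0`), keeping the
arithmetic factor `G_{ℚ_p}` (discrete copy `Gam p`) and `K := ℚ_p`:
* `expA`, `eHat` — the `a`-exponent sum `F₂ → ℤ` and its completion `ê : F̂₂ → Ẑ`; `Gfp` — the fibre
  product subgroup `{(x, n) | ê x = ι n}`; `isProfiniteCompletion_gfpFst`, `gfpFst_injective`,
  `gfpSnd_surjective`, `isOpen_ker_gfpSnd` (w5-d218's theorems instantiated);
* `curve₂ p : TemperedCurve p` — `Π^tp := Γ × G_{ℚ_p}`, `Π := F̂₂ × Ĝ_{ℚ_p}`,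
  `toHat := pr₁ × η_Γ` (an `IsProfiniteCompletion` by w5-d218's `IsProfiniteCompletion.prodMap`), no points;
* `deltaHat₂_eq : Δ_X = F̂₂ × 1`, `isFreeProfiniteOnTwo_deltaHat₂`.
The theta layer over `curve₂` (with `hYcl` TRUE) is the sequel `SettingModel2.lean`. Consistency evidence
only; not the `π₁` of a curve; nothing of [EtTh] asserted; no side taken on [IUTchIII] Cor. 3.12.
-/

noncomputable section

namespace Literature.AnabelianGeometry.EtaleTheta.SettingModel

open Literature.AnabelianGeometry.SemiGraphs
open CategoryTheory Function
open scoped commutatorElement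

/-! ### The completed exponent sum and the fibre product `Γ = F̂₂ ×_Ẑ ℤ` -/

/-- The `a`-exponent sum `F₂ → ℤ` (the `x`-coordinate of `heisHom`): the discrete shadow of `Π^tp_X ↠ Z`.
[cite: MochizukiEtTh2009, §1 p.12] -/
def expA : F₂ →* Multiplicative ℤ := Heis.xHom.comp heisHom

/-- [cite: MochizukiEtTh2009, §1 p.12] -/
theorem expA_apply (g : F₂) : expA g = Multiplicative.ofAdd (heisHom g).x := rfl

/-- `expA` is surjective. [cite: MochizukiEtTh2009, §1 p.12] -/
theorem expA_surjective : Surjective expA := by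
  intro n
  obtain ⟨h, hh⟩ := heisHom_surjective ⟨Multiplicative.toAdd n, 0, 0⟩
  exact ⟨h, by simp [expA_apply, hh]⟩

/-- The carrier of `Ẑ`. [cite: MochizukiEtTh2009, §1 p.12] -/
abbrev ZH : Type := ZHat

/-- `ι : ℤ → Ẑ`. [cite: MochizukiEtTh2009, §1 p.12] -/
def iotaZ : Multiplicative ℤ →* ZH := Literature.IUT.HodgeTheaters.toCompletion (Multiplicative ℤ)

/-- `ι : ℤ → Ẑ` is injective. [cite: MochizukiEtTh2009, §1 p.12] -/
theorem iotaZ_injective : Injective iotaZ := Literature.IUT.HodgeTheaters.toCompletion_int_injective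

/-- **`ê : F̂₂ → Ẑ`**, the continuous extension of the `a`-exponent sum ("`Π_X ↠ Ẑ`" completing
"`Π^tp_X ↠ Z`", p. 12 / Rmk. 1.6.4 p. 26). [cite: MochizukiEtTh2009, §1 p.12] -/
def eHat : F₂hatT →ₜ* ZH :=
  (ProfiniteGrp.ProfiniteCompletion.lift (P := ZHat) (GrpCat.ofHom (iotaZ.comp expA))).hom

/-- `ê (η g) = ι (expA g)`. [cite: MochizukiEtTh2009, §1 p.12] -/
theorem eHat_eta (g : F₂) : eHat (eta g) = iotaZ (expA g) :=
  lift_hom_toCompletion ZHat (iotaZ.comp expA) g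

/-- **The fibre product `Γ := F̂₂ ×_Ẑ ℤ`** (abc-iut-w5-d218's tempered group): `(x, n) ∈ Γ ↔ ê x = ι n`.
[cite: MochizukiEtTh2009, §1 p.12] -/
def Gfp : Subgroup (F₂hatT × Multiplicative ℤ) :=
  (eHat.toMonoidHom.comp (MonoidHom.fst F₂hatT (Multiplicative ℤ))).eqLocus
    (iotaZ.comp (MonoidHom.snd F₂hatT (Multiplicative ℤ)))

/-- [cite: MochizukiEtTh2009, §1 p.12] -/
theorem mem_Gfp (q : F₂hatT × Multiplicative ℤ) : q ∈ Gfp ↔ eHat q.1 = iotaZ q.2 := Iff.rfl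

/-- The graph element `(η g, expA g) ∈ Γ`. [cite: MochizukiEtTh2009, §1 p.12] -/
theorem eta_mk_mem_Gfp (g : F₂) : ((eta g, expA g) : F₂hatT × Multiplicative ℤ) ∈ Gfp :=
  (mem_Gfp _).mpr (eHat_eta g)

/-- `pr₁ : Γ → F̂₂` (continuous). [cite: MochizukiEtTh2009, §1 p.12] -/
def gfpFst : Gfp →ₜ* F₂hatT :=
  ⟨(MonoidHom.fst F₂hatT (Multiplicative ℤ)).comp Gfp.subtype, continuous_fst.comp continuous_subtype_val⟩

/-- `pr₂ : Γ → ℤ` ("`Π^tp_X ↠ Z`" on the geometric factor). [cite: MochizukiEtTh2009, §1 p.12] -/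
def gfpSnd : Gfp →* Multiplicative ℤ := (MonoidHom.snd F₂hatT (Multiplicative ℤ)).comp Gfp.subtype

/-- [cite: MochizukiEtTh2009, §1 p.12] -/
theorem gfpFst_apply (q : Gfp) : gfpFst q = (q : F₂hatT × Multiplicative ℤ).1 := rfl

/-- [cite: MochizukiEtTh2009, §1 p.12] -/
theorem gfpSnd_apply (q : Gfp) : gfpSnd q = (q : F₂hatT × Multiplicative ℤ).2 := rfl

/-- Finite-index normal subgroups of `F₂` are cut out by open normal subgroups of `F̂₂`. [folklore] -/
private theorem hEtaN : ∀ N : Subgroup F₂, N.Normal → N.FiniteIndex →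
    ∃ V : OpenNormalSubgroup F₂hatT, ∀ g, eta g ∈ V ↔ g ∈ N :=
  fun N _ _ => exists_openNormal_eta_mem_iff N

/-- `ι` separates finite-index subgroups of `ℤ`. [folklore] -/
private theorem hZsep : ∀ A : Subgroup (Multiplicative ℤ), A.FiniteIndex →
    ∀ k : Multiplicative ℤ, iotaZ k ∈ closure (iotaZ '' (A : Set (Multiplicative ℤ))) → k ∈ A :=
  fun A hA k hk => by haveI := hA; exact mem_of_toCompletion_mem_closure A k hk

/-- **`pr₁ : Γ → F̂₂` is a profinite completion** (L3 predicate; abc-iut-w5-d218's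
`TemperedFibreProduct.isProfiniteCompletion_fst`). [cite: MochizukiEtTh2009, §1 p.12] -/
theorem isProfiniteCompletion_gfpFst : IsProfiniteCompletion gfpFst :=
  TemperedFibreProduct.isProfiniteCompletion_fst eHat iotaZ Gfp mem_Gfp eta denseRange_eta hEtaN expA
    expA_surjective eHat_eta hZsep gfpFst gfpFst_apply

/-- `pr₁` is injective. [cite: MochizukiEtTh2009, §1 p.12] -/
theorem gfpFst_injective : Injective gfpFst :=
  TemperedFibreProduct.fst_injective eHat iotaZ Gfp mem_Gfp iotaZ_injective

/-- `pr₂ : Γ → ℤ` is surjective. [cite: MochizukiEtTh2009, §1 p.12] -/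
theorem gfpSnd_surjective : Surjective gfpSnd :=
  TemperedFibreProduct.snd_surjective_of eHat iotaZ Gfp mem_Gfp
    (TemperedFibreProduct.exists_apply_eq_iota eHat iotaZ eta expA expA_surjective eHat_eta)

/-- `Ker pr₂` is open in `Γ`. [cite: MochizukiEtTh2009, §1 p.12] -/
theorem isOpen_ker_gfpSnd : IsOpen (gfpSnd.ker : Set Gfp) := TemperedFibreProduct.isOpen_ker_snd Gfp

/-! ### `Π^tp_X := Γ × G_{ℚ_p}` and the tempered-curve layer -/

variable (p : ℕ) [Fact p.Prime]

/-- `Π^tp_X := Γ × Γ_{arith}` for the finer model. [cite: MochizukiEtTh2009, §1 p.12] -/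
abbrev PiTp₂ : Type := Gfp × Gam p

/-- `Π^tp_X → Π_X = F̂₂ × Ĝ_{ℚ_p}`: `pr₁ × η_Γ`. [cite: MochizukiEtTh2009, §1 p.12] -/
def toHat₂ : PiTp₂ p →ₜ* PiHt p := gfpFst.prodMap (etaCont (Gam p))

/-- [cite: MochizukiEtTh2009, §1 p.12] -/
theorem toHat₂_apply (g : PiTp₂ p) :
    toHat₂ p g = ((g.1 : F₂hatT × Multiplicative ℤ).1, etaGam p g.2) := rfl

/-- The augmentation of the finer model: the second projection onto `G_{ℚ_p}`. [cite: MochizukiEtTh2009, §1 p.12] -/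
def augM₂ : PiTp₂ p →ₜ* GQp p := (Gam.toGQp p).comp (ContinuousMonoidHom.snd Gfp (Gam p))

/-- **The tempered-curve layer of the finer model**: `K := ℚ_p`, `Π^tp := (F̂₂ ×_Ẑ ℤ) × G_{ℚ_p}`,
`Π := F̂₂ × Ĝ_{ℚ_p}`, no closed points. [cite: MochizukiEtTh2009, §1 p.11] -/
abbrev curve₂ : TemperedCurve p where
  K := ⊥
  finiteDimensional_K := inferInstance
  PiTemp := PiTp₂ p
  aug := augM₂ p
  range_aug := by
    rw [IntermediateField.fixingSubgroup_bot]
    exact MonoidHom.range_eq_top.mpr fun σ => ⟨((1 : Gfp), (σ : Gam p)), rfl⟩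
  PiHat := PiHt p
  toHat := toHat₂ p
  isProfiniteCompletion_toHat :=
    IsProfiniteCompletion.prodMap isProfiniteCompletion_gfpFst
      (isProfiniteCompletion_of_eta (etaCont (Gam p)) fun _ => rfl)
  toHat_injective := gfpFst_injective.prodMap (etaGam_injective p)
  augHat := augHatM p
  augHat_comp g := augHatGam_etaGam p g.2
  Pt := PEmpty
  IsCusp _ := False
  decomp x := x.elim
  isClosed_decomp x := x.elim
  isOpen_aug_decomp x := x.elim
  inertia_eq_bot x := x.elim
  inertia_equiv_zHat x := x.elim

/-- `Δ^tp_X = Ker(aug) = {(γ, 1)}`. [cite: MochizukiEtTh2009, §1 p.12] -/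
theorem mem_deltaTemp₂_iff (g : PiTp₂ p) : g ∈ (curve₂ p).DeltaTemp ↔ g.2 = 1 := Iff.rfl

/-- `F̂₂ × 1` is closed in `Π_X`. [folklore] -/
private theorem isClosed_prod_bot₂ :
    IsClosed (((⊤ : Subgroup F₂hatT).prod (⊥ : Subgroup (GamHatT p)) : Subgroup (PiHt p)) :
      Set (PiHt p)) := by
  have : (((⊤ : Subgroup F₂hatT).prod (⊥ : Subgroup (GamHatT p)) : Subgroup (PiHt p)) :
      Set (PiHt p)) = Set.univ ×ˢ {1} := by
    ext x
    simp [Subgroup.mem_prod, Subgroup.mem_bot]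
  rw [this]
  exact isClosed_univ.prod isClosed_singleton

/-- **`Δ_X = F̂₂ × 1`** for the finer model as well (the image of `Γ` in `F̂₂` contains the dense `η(F₂)`).
[cite: MochizukiEtTh2009, §1 p.12] -/
theorem deltaHat₂_eq : (curve₂ p).DeltaHat = (⊤ : Subgroup F₂hatT).prod (⊥ : Subgroup (GamHatT p)) := by
  apply le_antisymm
  · refine Subgroup.topologicalClosure_minimal _ ?_ (isClosed_prod_bot₂ p)
    rintro _ ⟨g, hg, rfl⟩
    have hg' : g.2 = 1 := (mem_deltaTemp₂_iff p g).mp hg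
    refine ⟨trivial, ?_⟩
    show etaGam p g.2 ∈ (⊥ : Subgroup _)
    rw [hg', map_one]
    exact Subgroup.one_mem _
  · rintro ⟨x, y⟩ hxy
    obtain ⟨-, hy⟩ := Subgroup.mem_prod.mp hxy
    rw [Subgroup.mem_bot] at hy
    subst hy
    have hsub : Set.range eta ×ˢ ({1} : Set (GamHatT p)) ⊆
        (((curve₂ p).DeltaTemp.map (curve₂ p).toHat.toMonoidHom : Subgroup (PiHt p)) : Set (PiHt p)) := by
      rintro ⟨a, b⟩ ⟨⟨g, rfl⟩, hb⟩
      rw [Set.mem_singleton_iff] at hb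
      subst hb
      refine ⟨(⟨(eta g, expA g), eta_mk_mem_Gfp g⟩, (1 : Gam p)), (mem_deltaTemp₂_iff p _).mpr rfl, ?_⟩
      show ((eta g, etaCont (Gam p) 1) : PiHt p) = (eta g, 1)
      rw [map_one]
    have hx : ((x, 1) : PiHt p) ∈ closure (Set.range eta ×ˢ ({1} : Set (GamHatT p))) := by
      rw [closure_prod_eq, Set.mem_prod]
      exact ⟨denseRange_eta x, subset_closure rfl⟩
    have key := closure_mono hsub hx
    rwa [← Subgroup.topologicalClosure_coe] at key

/-- Elements of `Δ_X` have trivial `Γ̂`-component. [cite: MochizukiEtTh2009, §1 p.12] -/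
theorem snd_eq_one_of_mem_deltaHat₂ {x : PiHt p} (hx : x ∈ (curve₂ p).DeltaHat) : x.2 = 1 := by
  rw [deltaHat₂_eq] at hx
  exact (Subgroup.mem_bot).mp hx.2

/-- `(x, 1) ∈ Δ_X`. [cite: MochizukiEtTh2009, §1 p.12] -/
theorem mk_one_mem_deltaHat₂ (x : F₂hatT) : ((x, 1) : PiHt p) ∈ (curve₂ p).DeltaHat := by
  rw [deltaHat₂_eq]
  exact ⟨trivial, (Subgroup.mem_bot).mpr rfl⟩

/-- `Δ_X` is normal in `Π_X` (finer model). [cite: MochizukiEtTh2009, §1 p.12] -/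
theorem deltaHat₂_normal : (curve₂ p).DeltaHat.Normal := by
  rw [deltaHat₂_eq]
  infer_instance

/-- `Δ_X ≃ₜ* F̂₂` (finer model). [cite: MochizukiEtTh2009, §1 p.12] -/
def deltaHat₂Equiv : F₂hatT ≃ₜ* (curve₂ p).DeltaHat where
  toFun x := ⟨(x, 1), mk_one_mem_deltaHat₂ p x⟩
  invFun y := (Subtype.val y).1
  left_inv x := rfl
  right_inv y := by
    apply Subtype.ext
    exact Prod.ext rfl (snd_eq_one_of_mem_deltaHat₂ p y.2).symm
  map_mul' x y := rfl
  continuous_toFun := by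
    apply Continuous.subtype_mk
    exact continuous_id.prodMk continuous_const
  continuous_invFun := continuous_fst.comp continuous_subtype_val

/-- **`Δ_X` of the finer model is profinite free on two generators.** [cite: MochizukiEtTh2009, §1 p.12] -/
theorem isFreeProfiniteOnTwo_deltaHat₂ : IsFreeProfiniteOnTwo (curve₂ p).DeltaHat :=
  IsFreeProfiniteOnTwo.of_continuousMulEquiv (deltaHat₂Equiv p)
    isFreeProfiniteOnTwo_profiniteCompletion_freeGroup

end Literature.AnabelianGeometry.EtaleTheta.SettingModel

end
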